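import Literature.MathematicalPhysics.QuantumFieldTheory.Balaban1983to89.B9Thm39CinvAtCover
import Literature.MathematicalPhysics.QuantumFieldTheory.Balaban1983to89.B9GeoInputsMultiRateKLevelV1

/-!
# `Balaban1983to89.B9Thm39CinvAtCoverAbove` — [Balaban1985BackgroundPropagators] THEOREM 3.9 pp. 411–413 ⇒ THEOREM 3.2 (3.48) p. 398 FOR
# `C(U) = (Q′G′²Q′*)⁻¹(U)` AT THE CUBE COVER OF RECORD, FOR EVERY MEMBER OF THE k-LEVEL V1 FAMILY ABOVE ONE M-THRESHOLD («For M sufficiently large»): FILE 10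
# with [4] Lemma 2.1 at the three rate pairs, (2.63) and the two p. 398 scale transfers DISCHARGED by FILE 11 (cell `lit-balaban`, G-B9-LETTERS module M5.6
# FILE 12, seat p21 gen 33)

statement-level skeleton of published theorems with citation tags; proofs where landed; nothing here is a claim about the Yang–Mills mass gap

CITATION HEADER (lean-in-tree rule).  B9 = T. Bałaban, *Propagators for lattice gauge theories in a background field*, Commun. Math. Phys. **99** (1985)
389–434: p. 413 Theorem 3.9 «For M sufficiently large, and a configuration U satisfying (3.35), the operator (Q′G′²Q′*)⁻¹ can be represented …  This theorem
implies Theorem 3.2»; p. 398 Theorem 3.2 (3.48) «|(Q′(U)G′²(U)Q′*(U))⁻¹(y, y′)| ≦ B₀(Lʲη)⁻⁴(L^{j′}η)^{−d}e^{−δ₀d(y,y′)}, y, y′ ∈ 𝔅»; p. 398 «Using Lemma 2.1 in [4] we may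
replace the factor (Lʲη)^α by (Lʲη)^β(L^{j′}η)^γ»; p. 408 (the cover 𝒟, «Σ h²_□ = 1»); pp. 411–412 (3.95)–(3.97).  [4] = [Balaban1984PropagatorsII] Lemma 2.1
(2.59)–(2.61), (2.63) pp. 233–234, (2.54) p. 233, (2.83)–(2.85) pp. 237–238.  Rows B9.Thm3.9 × B9.Thm3.2 × B4.Lem2.1 (cells only; no row head changes).

WHY THIS FILE.  FILE 10 (`B9Thm39CinvAtCover.hasMajorant_conj_XinvY_of_eBlockInv_cover`) still displays, for the member `i`, the geometric facts of [4] Lemma 2.1: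
(2.61) at `((1−α_G)δ_G, α₂)` (exponent `d₂`), at `(δ₀, b−ρ)` and `(ρδ₀, α′)` (common exponent `d′`), (2.63) at `(ρδ₀, α′)`, and the p. 398 scale transfers for `ℓ²`
(constant `C_G`) and `ℓ⁻⁴` (constant `C`).  FILE 11 (`B9GeoInputsMultiRateKLevelV1`) proves all of them for every member above ONE existential threshold (exponents
`exp261` by choice, constants `L²`, `L⁴`, size conditions `2·log L ≦ α_Gδ_G(2L²−1)M`, `4·log L ≦ α_stδ₀(2L²−1)M`).  THIS FILE is the composition: the printed
«For M sufficiently large» as `∃ M_L (and exponents d₂, d′), ∀ members with M_L ≦ M`.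

WHAT IS PROVED (all `theorem`s, 0 `def`, 0 sorry, 0 new named facts).
* `size_of_threshold` — bookkeeping: `c/κ ≦ M ⇒ c ≦ κ(2L²−1)M` (`κ > 0`, `c ≧ 0`).
* ★★★ `cinv_cover_above` — for rate data `α_Gδ_G > 0`, `0 < α₂ ≦ 1`, `(1−α_G)δ_G > 0`, `δ₀ > 0`, `0 < ρ < b`, `0 < α′ ≦ 1`, `α_st > 0`: THERE ARE `M_L`, `d₂`, `d′` such that for
  EVERY member `i` of the k-level V1 family with `M_L ≦ M_i`, and every datum of FILE 10 at `i` (M5.5's `EBlock`s of `G′` and of the `G′_□` with constants `B_G`, `δ_G`;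
  the section `ιB`; `IsUnit XY`; contractive transporters; the coordinate bound `M₂` of the basis `b`; the cube letters `C_□` with local inverse property `hloc` and
  un-localized (3.48) blocks `hC`; the LOCALIZED [2]-difference majorants `hD` (GAP G-B9-05); the target rate `a_Lδ₀ ≦ (1−α₂)(1−α_G)δ_G`, the exponent splits, the
  equation binders `κ_G`, `θ₁`, `θ₂`, `θ₃` now WITH `C_G = L²`, `C = L⁴` and the located smallness `(θ₁+θ₂+θ₃)c₁(d′, ρδ₀, α′) < 1`):
  `conj b ((η²η²)⁻¹•(Q′G′²Q′*)⁻¹(U)) ≺ 3·5^{d+1}B₀c₁(d′,ρδ₀,α′)(1 − (θ₁+θ₂+θ₃)c₁)⁻¹·ℓ(a)⁻⁴·e^{−(1−α′)ρδ₀d(a,a′)}` on the block carrier.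

HONEST SCOPE / NOT CLAIMED.  FILE 10's scope with the geometry discharged; the threshold and the exponents are EXISTENTIAL (the tree's door construction; no numerical
`M`); the smallness `(θ₁+θ₂+θ₃)c₁ < 1` is still LOCATED at the member (print: part of «M sufficiently large» — here `θ₁ ∝ e^{−a_sepδ₀M/(2L²)}`, `θ₂ ∝ κ_De^{−δ₀M/L²}`,
`θ₃ ∝ s_T/M` are explicit but their comparison with `c₁` is not performed); displayed remain M5.5's `EBlock`s, the cube letters (M5.2-E), `hD` (GAP G-B9-05), `IsUnit XY`,
transporter/coordinate bounds.  Sup-entry (3.48) only; finite 𝕋 members of the k-level V1 family; nothing continuum, nothing about the mass gap; NOT summit progress.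
RELATED, NOT DUPLICATED: FILE 10 (fixed member, geometry displayed — USED BY NAME), FILE 11 (the geometry — USED BY NAME).
Searched 2026-08-28: `lean search 'CinvAtCoverAbove|cinv_cover_above' --decl` = ∅.
-/

noncomputable section

namespace Literature.MathematicalPhysics.QuantumFieldTheory.Balaban1983to89.B9Thm39CinvAtCoverAbove

open Node00 B9CubeLettersInvReadings
open B6Cover236MultiLevelBlocks (cubes)
open B6Cover236MultiLevelTorusBlocks (hB cubeIndT)
open B6Ineq2142KLevelV1 (β)
open B6KLevelCensusIndexV1 (KIdx)
open B6RandomWalk (HasMajorant)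
open B9Thm34Ext (toB6)
open B9FromB6 (EBlock)
open B9GeoNormsKLevelV1 (geo9K)
open B9GeoLemma21KLevelV1 (one_le_Mh geo9K_M_nonneg)
open B9RWSums347DefiniteFaces (exp261)
open B9Eq352DivFormLetters (conj)
open B9Thm37CubeCoverCommutators (cutMulY)
open B9Thm37CubeCoverCommutatorSizes (four_le_P')
open B9Thm39CinvAtCover (chiBigT DsepT lipT hasMajorant_conj_XinvY_of_eBlockInv_cover)
open B9GeoInputsMultiRateKLevelV1 (geo_inputs3_geo9K scaleTransfer_len_sq_geo9K scaleTransfer_len_inv4_geo9K)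

variable {d ℓ : ℕ} {hd : 1 ≤ d + 1} {hL : Odd (ℓ + 1) ∧ 1 < ℓ + 1} {b₀ b₁ : ℝ}
variable {𝔸 : Type} [NormedRing 𝔸] [NormedAlgebra ℂ 𝔸] [CompleteSpace 𝔸]
variable {ι : Type} [Fintype ι] [DecidableEq ι]

/-- bookkeeping for the explicit size conditions: `c/κ ≦ M ⇒ c ≦ κ(2L²−1)M` (`κ > 0`, `c ≧ 0`, `2L² − 1 ≧ 1`).
[cite: Balaban1984PropagatorsII, (2.59) p.233 (size conditions on RM), bookkeeping] -/
theorem size_of_threshold {κ c M : ℝ} (hκ : 0 < κ) (hc : 0 ≤ c) (hM : c / κ ≤ M) : c ≤ κ * (2 * ((ℓ : ℝ) + 1) ^ 2 - 1) * M := by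
  have hcM : c ≤ κ * M := by rw [div_le_iff₀ hκ] at hM; linarith
  have hM0 : 0 ≤ M := le_trans (div_nonneg hc hκ.le) hM
  have hR1 : (1 : ℝ) ≤ 2 * ((ℓ : ℝ) + 1) ^ 2 - 1 := by nlinarith [(Nat.cast_nonneg ℓ : (0 : ℝ) ≤ ℓ)]
  calc c ≤ κ * M := hcM
    _ = κ * 1 * M := by ring
    _ ≤ κ * (2 * ((ℓ : ℝ) + 1) ^ 2 - 1) * M := mul_le_mul_of_nonneg_right (mul_le_mul_of_nonneg_left hR1 hκ.le) hM0

/-- ★★★ **THEOREM 3.9 ⇒ THEOREM 3.2 (3.48) FOR `C(U) = (Q′G′²Q′*)⁻¹(U)` AT THE CUBE COVER OF RECORD, FOR EVERY MEMBER ABOVE ONE THRESHOLD** («For M sufficiently large …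
This theorem implies Theorem 3.2»): for rate data `α_Gδ_G > 0`, `0 < α₂ ≦ 1`, `(1−α_G)δ_G > 0`, `δ₀ > 0`, `0 < ρ < b`, `0 < α′ ≦ 1`, `α_st > 0` there are a threshold `M_L`
and exponents `d₂`, `d′` such that for every member `i` with `M_L ≦ M_i` FILE 10's statement holds with its geometric binders discharged ([4] Lemma 2.1 at the three
rate pairs, (2.63), the scale transfers of `ℓ²`/`ℓ⁻⁴` with constants `L²`/`L⁴`): from M5.5's `EBlock`s of `G′ = O` and of the `G′_□ = Oc □`, `IsUnit XY`, contractive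
transporters, the coordinate bound, the per-cube `hloc`/`hC`/localized `hD` at the cover of record, the rate bookkeeping and the located smallness,
`conj b ((η²η²)⁻¹•XinvY i parS O U) ≺ 3·5^{d+1}B₀c₁(d′,ρδ₀,α′)(1 − (θ₁+θ₂+θ₃)c₁(d′,ρδ₀,α′))⁻¹·ℓ(a)⁻⁴·e^{−(1−α′)ρδ₀d(a,a′)}`.
[cite: Balaban1985BackgroundPropagators, Thm 3.9 p.413 + Thm 3.2 (3.48) p.398 + p.398 (scale transfer) + (3.95)–(3.97) pp.411–412 + p.408;
Balaban1984PropagatorsII, Lemma 2.1 (2.59)–(2.61), (2.63) pp.233–234 + (2.83)–(2.85) pp.237–238] -/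
theorem cinv_cover_above [∀ i' : KIdx d ℓ hd hL b₀ b₁, Fintype (geo9K i').Site] [∀ i' : KIdx d ℓ hd hL b₀ b₁, DecidableEq (geo9K i').Site]
    (Rr : KIdx d ℓ hd hL b₀ b₁ → ℝ) (Hp : KIdx d ℓ hd hL b₀ b₁ → Prop) (b : Module.Basis ι ℝ 𝔸)
    {M₂ : ℝ} (hM₂ : 0 ≤ M₂) (hrepr : ∀ (v : 𝔸) (j : ι), |b.repr v j| ≤ M₂ * ‖v‖)
    {δG αG α₂ δ₀ αst bb ρ α' : ℝ} (hαGδ : 0 < αG * δG) (hα₂0 : 0 < α₂) (hα₂1 : α₂ ≤ 1) (hδG : 0 < (1 - αG) * δG)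
    (hδ₀ : 0 < δ₀) (hρ : 0 < ρ) (hρb : ρ < bb) (hα'0 : 0 < α') (hα'1 : α' ≤ 1) (hαst : 0 < αst) :
    ∃ (ML : ℝ) (d₂ d' : ℕ), ∀ i : KIdx d ℓ hd hL b₀ b₁, ML ≤ (geo9K i).M →
      ∀ {B : B9.Backgrounds} (cfg : B.Cfg → CfgY 𝔸 i) (O : SiteOpY 𝔸 i) (parS : SiteParY 𝔸 i) {U₁ : B.Cfg} (ιB : BlkY i → IBondY i)
        (Oc : ↥(cubes i.D.toDomains) → SiteOpY 𝔸 i) {BG : ℝ}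
        (hE : EBlock (kernelFamilySInv i B cfg O parS) BG δG U₁) (hEc : ∀ c, EBlock (kernelFamilySInv i B cfg (Oc c) parS) BG δG U₁)
        (hBG : 0 ≤ BG) (hι : ∀ s, β i.hN i.D i.hk (ιB s) = s)
        (hunit : IsUnit (XY i parS O (cfg U₁)))
        (hpar : ∀ z w : SiteY i, ‖(parS (cfg U₁) z w : 𝔸)‖ ≤ 1 ∧ ‖(((parS (cfg U₁) z w)⁻¹ : 𝔸ˣ) : 𝔸)‖ ≤ 1)
        (Cl : ↥(cubes i.D.toDomains) → Module.End ℝ (BlkY i → 𝔸))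
        {aL aD αc asep κG κD B₀ θ₁ θ₂ θ₃ : ℝ} (hrate : aL * δ₀ ≤ (1 - α₂) * ((1 - αG) * δG))
        (hκD : 0 ≤ κD) (hB₀ : 0 ≤ B₀) (hasep : 0 ≤ asep) (hαc : 0 < αc * δ₀)
        (hsplit₁ : αst + asep + ρ ≤ aL) (hsplit₂ : αst + ρ ≤ aD) (hsplit₃ : αst + αc + ρ ≤ aL)
        (hκG : κG = (M₂ * (∑ j, ‖b j‖) * BG) ^ 2 * ((ℓ : ℝ) + 1) ^ 2 * B6.c1 d₂ ((1 - αG) * δG) α₂)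
        (hθ₁ : θ₁ = (3 * 5 ^ (d + 1)) * (((M₂ * ∑ j, ‖b j‖) ^ 2 * κG) * B₀ * ((ℓ : ℝ) + 1) ^ 4 * B6.c1 d' δ₀ (bb - ρ) *
          Real.exp (-(asep * δ₀ * DsepT i))))
        (hθ₂ : θ₂ = (3 * 5 ^ (d + 1)) * (κD * Real.exp (-(2 * δ₀ * DsepT i)) * B₀ * ((ℓ : ℝ) + 1) ^ 4 * B6.c1 d' δ₀ (bb - ρ)))
        (hθ₃ : θ₃ = (3 * 5 ^ (d + 1)) * ((lipT i * (αc * δ₀)⁻¹) * ((M₂ * ∑ j, ‖b j‖) ^ 2 * κG) * B₀ * ((ℓ : ℝ) + 1) ^ 4 * B6.c1 d' δ₀ (bb - ρ)))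
        (hsmall : (θ₁ + θ₂ + θ₃) * B6.c1 d' (ρ * δ₀) α' < 1)
        (hloc : ∀ c, (cutMulY (𝔸 := 𝔸) (hB i.D c)).restrictScalars ℝ *
          ((cutMulY (𝔸 := 𝔸) (chiBigT i c)).restrictScalars ℝ * (XY i parS (Oc c) (cfg U₁)).restrictScalars ℝ) * Cl c *
            (cutMulY (𝔸 := 𝔸) (hB i.D c)).restrictScalars ℝ =
          (cutMulY (𝔸 := 𝔸) (hB i.D c)).restrictScalars ℝ * (cutMulY (𝔸 := 𝔸) (hB i.D c)).restrictScalars ℝ)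
        (hC : ∀ c, HasMajorant (g := toB6 (geo9K i) (Rr i) (Hp i)) (fun p : BlkY i × ι => ιB p.1) (conj b ((etaS i ^ 2 * etaS i ^ 2)⁻¹ • Cl c))
          (fun a a' => B₀ * ((geo9K i).len a ^ 4)⁻¹ * Real.exp (-(bb * δ₀ * (geo9K i).dist a a'))))
        (hD : ∀ c, HasMajorant (g := toB6 (geo9K i) (Rr i) (Hp i)) (fun p : BlkY i × ι => ιB p.1)
          (conj b ((etaS i ^ 2 * etaS i ^ 2) • ((cutMulY (𝔸 := 𝔸) (chiBigT i c)).restrictScalars ℝ *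
            ((XY i parS O (cfg U₁)).restrictScalars ℝ - (XY i parS (Oc c) (cfg U₁)).restrictScalars ℝ) *
            (cutMulY (𝔸 := 𝔸) (cubeIndT i.D (one_le_Mh i) (four_le_P' i) c)).restrictScalars ℝ)))
          (fun a a'' => κD * Real.exp (-(2 * δ₀ * DsepT i)) * (geo9K i).len a ^ 4 * Real.exp (-(aD * δ₀ * (geo9K i).dist a a'')))),
        HasMajorant (g := toB6 (geo9K i) (Rr i) (Hp i)) (fun p : BlkY i × ι => ιB p.1)
          (conj b ((etaS i ^ 2 * etaS i ^ 2)⁻¹ • (XinvY i parS O (cfg U₁)).restrictScalars ℝ))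
          (fun a a' => (3 * 5 ^ (d + 1)) * B₀ * B6.c1 d' (ρ * δ₀) α' * (1 - (θ₁ + θ₂ + θ₃) * B6.c1 d' (ρ * δ₀) α')⁻¹ * ((geo9K i).len a ^ 4)⁻¹ *
            Real.exp (-((1 - α') * (ρ * δ₀) * (geo9K i).dist a a'))) := by
  -- [4] Lemma 2.1 at the three rate pairs (FILE 11), pairs 2 and 3 at the common exponent
  have h₁ : 0 < α₂ * ((1 - αG) * δG) := mul_pos hα₂0 hδG
  have h₂ : 0 < (bb - ρ) * δ₀ := mul_pos (sub_pos.mpr hρb) hδ₀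
  have h₃ : 0 < α' * (ρ * δ₀) := mul_pos hα'0 (mul_pos hρ hδ₀)
  obtain ⟨ML₀, hgeo⟩ := geo_inputs3_geo9K Rr Hp h₁ h₂ h₃ (mul_pos hρ hδ₀).le hα'1
  have hlog : 0 ≤ Real.log ((ℓ : ℝ) + 1) := Real.log_nonneg (by linarith [(Nat.cast_nonneg ℓ : (0 : ℝ) ≤ ℓ)])
  have hst : 0 < αst * δ₀ := mul_pos hαst hδ₀
  refine ⟨max ML₀ (max (2 * Real.log ((ℓ : ℝ) + 1) / (αG * δG)) (4 * Real.log ((ℓ : ℝ) + 1) / (αst * δ₀))),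
    exp261 (geo9K (d := d) (ℓ := ℓ) (hd := hd) (hL := hL) (b₀ := b₀) (b₁ := b₁)) ((1 - αG) * δG) α₂,
    max (exp261 (geo9K (d := d) (ℓ := ℓ) (hd := hd) (hL := hL) (b₀ := b₀) (b₁ := b₁)) δ₀ (bb - ρ))
      (exp261 (geo9K (d := d) (ℓ := ℓ) (hd := hd) (hL := hL) (b₀ := b₀) (b₁ := b₁)) (ρ * δ₀) α'), fun i hM => ?_⟩
  intro B cfg O parS U₁ ιB Oc BG hE hEc hBG hι hunit hpar Cl aL aD αc asep κG κD B₀ θ₁ θ₂ θ₃ hrate hκD hB₀ hasep hαc hsplit₁ hsplit₂ hsplit₃ hκG hθ₁ hθ₂ hθ₃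
    hsmall hloc hC hD
  obtain ⟨htri, hrefl, hsymm, hdnn, h261G, h261b, h261, h263⟩ := hgeo i ((le_max_left _ _).trans hM)
  -- the two p. 398 scale transfers from the explicit size conditions folded into the threshold
  have hMG : 2 * Real.log ((ℓ : ℝ) + 1) ≤ αG * δG * (2 * ((ℓ : ℝ) + 1) ^ 2 - 1) * (geo9K i).M :=
    size_of_threshold hαGδ (by positivity) (((le_max_left _ _).trans (le_max_right _ _)).trans hM)
  have hMst : 4 * Real.log ((ℓ : ℝ) + 1) ≤ αst * δ₀ * (2 * ((ℓ : ℝ) + 1) ^ 2 - 1) * (geo9K i).M :=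
    size_of_threshold hst (by positivity) (((le_max_right _ _).trans (le_max_right _ _)).trans hM)
  have hSTG := scaleTransfer_len_sq_geo9K i hαGδ hMG
  have hST := scaleTransfer_len_inv4_geo9K i hst hMst
  exact hasMajorant_conj_XinvY_of_eBlockInv_cover i b cfg O parS ιB (Rr := Rr i) (Hp := Hp i) Oc hE hEc hBG hι hunit hpar hM₂ hrepr _ _ (by positivity)
    hαGδ.le hα₂0.le hα₂1 hδG.le hSTG h261G hrate Cl hκD hB₀ (by positivity) hδ₀.le hasep hρ.le hρb.le hαc hα'1 hsplit₁ hsplit₂ hsplit₃ hκG hθ₁ hθ₂ hθ₃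
    hST h261b h261 h263 hsmall hloc hC hD

end Literature.MathematicalPhysics.QuantumFieldTheory.Balaban1983to89.B9Thm39CinvAtCoverAbove

end
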